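import Summits.ResolutionOfSingularities.ResolutionOfSingularities.Theorems.PurelyInseparableDim4PointTreeLocal
import Summits.ResolutionOfSingularities.ResolutionOfSingularities.Theorems.PurelyInseparableDim4Mode0Plateau
import HarnessLib

/-!
# Purely inseparable four-folds: termination ⇒ order reduction in the isolated regime with hypotheses on the WALK ONLY —
# finite branching of the point-centre walk replaces every scheme-side finiteness condition
# (brick TY-3k part 6 «POINT TREE, WALK FORM», cell `res-dim4-pi`)

[OURS · counted 0] (D-0157 DOOR 2; final form of the finite-tree assembly of `PIDim4.TerminationImpliesOrderReduction`,
MODE 0 (point centres), ISOLATED regime; host item stmt-ResolutionOfSingularities-16155, helper). Resolution of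
singularities in dimension ≥ 4 / characteristic `p` is NOT proved here or anywhere in this programme.

Part 5b asked, below every root state, for ONE-STEP FINITENESS of the MODEL (a scheme-side statement about the chosen
blowing up of `𝔸⁵_K` at the origin). By the cell's S3 (b) dictionary («closed order-`p` points of the transform =
equimultiple points of the walk», `…EquimultipleCover`) this is implied by FINITE BRANCHING of the tree's walk at the
state `s`: finitely many pairs `(j, b)`, `b_j = 0`, with `CentreBlowup.IsEquimultiplePoint p univ j b s`. Likewise the
closed order-`p` points of `z^p + F` on `𝔸⁵_K` are finitely many as soon as finitely many `b` make every non-constant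
monomial of degree `< p` of `F(x + b)` vanish. All hypotheses of the resulting theorem are statements about
polynomials and the tree's combinatorial walk.

* `isBlowup_blowupπ_𝓘Λ_univ` — the chosen blowing up of the origin is a blowing up along `V(z, x₁, …, x₄)`;
* `ordAlong_univ_of_reflTransGen_edge` — `p`-foldness propagates along edges;
* **`finite_closedOver_model_of_finite_pairs`** — finite branching at `s` ⇒ one-step finiteness of the model at `s`;
* **`finite_closedPoints_of_finite_roots`** — finitely many root parameters `b` ⇒ finitely many closed order-`p` points
  of `(z^p + F)·𝒪` on `𝔸⁵_K`;
* **`exists_isMarkedResolution_of_walk`** — `K = K̄` of characteristic `p`, `F ≠ 0` clean; finitely many root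
  parameters; below the re-centred state of each root the MODE-0 walk is well-founded and hereditarily finitely
  branching ⇒ `∃ X′ π M′, IsMarkedResolution ⟨hypSheaf p F, [], p⟩ π M′` (the conclusion of `PIDim4.OrderReduction p`
  for `F`). NOT `OrderReduction p`.

AI-produced formalisation, weaker than expert review. bears_on: LADDER-RESOLUTION:D157-DOOR2 (res-dim4-pi · TY-3k).
-/

set_option linter.dupNamespace false -- D-0017: single-problem summit path `Summit.<S>.<S>.…` by design

noncomputable section

open MvPolynomial Finset CategoryTheory AlgebraicGeometry Opposite TopologicalSpace

namespace Summit.ResolutionOfSingularities.ResolutionOfSingularities.Theorems.PIDim4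

open Literature.AlgebraicGeometry.Resolution
open Literature.AlgebraicGeometry.Resolution.Hauser2010
open Literature.AlgebraicGeometry.Resolution.AffinePointBlowup (P A γ coord Wtop ξ)

namespace Equimultiple

section Walk

variable {K : Type} [Field K] {p : ℕ} [hp : Fact p.Prime] [CharP K p]

omit hp [CharP K p] in
/-- The chosen blowing up of `𝔸⁵_K` at the origin is a blowing up along the point centre `V(z, x₁, …, x₄)` of the
coordinate-centre vocabulary (`Λ = Λ_univ`). [cite: GortzWedhorn2020, Def. 13.90] -/
theorem isBlowup_blowupπ_𝓘Λ_univ :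
    IsBlowup (blowup.π (Scheme.IdealSheafData.vanishingIdeal (AffinePointBlowup.C₀ 4 K)))
      (AffineCoordBlowup.𝓘Λ 4 K (insert 0 (Fin.succ '' ((Finset.univ : Finset (Fin 4)) : Set (Fin 4))))) := by
  rw [centreVars_univ, AffineCoordBlowup.𝓘Λ_univ]
  exact blowup.isBlowup _

omit hp [CharP K p] in
/-- The point centre in the coordinate-centre vocabulary is the vanishing ideal of the origin. [folklore] -/
theorem 𝓘Λ_univ_eq_vanishingIdeal :
    AffineCoordBlowup.𝓘Λ 4 K (insert 0 (Fin.succ '' ((Finset.univ : Finset (Fin 4)) : Set (Fin 4)))) =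
      Scheme.IdealSheafData.vanishingIdeal (AffinePointBlowup.C₀ 4 K) := by
  rw [centreVars_univ, AffineCoordBlowup.𝓘Λ_univ]
  rfl

omit hp [CharP K p] in
/-- **`p`-foldness propagates along the walk**: every state reachable by edges from a `p`-fold state is `p`-fold.
[cite: Hauser2010, §F] -/
theorem ordAlong_univ_of_reflTransGen_edge [DecidableEq K] {s s' : State K}
    (hs : (p : ℕ∞) ≤ CentreBlowup.ordAlong (Finset.univ : Finset (Fin 4)) s.F)
    (h : Relation.ReflTransGen (fun a b : State K => Edge p Finset.univ a b) s s') :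
    (p : ℕ∞) ≤ CentreBlowup.ordAlong (Finset.univ : Finset (Fin 4)) s'.F := by
  induction h with
  | refl => exact hs
  | tail _ hedge ih =>
    obtain ⟨j, b, -, -, heq, -, hs''⟩ := hedge
    rw [hs'']
    exact ordAlong_univ_step_of_isEquimultiplePoint j b _ heq

/-- **FINITE BRANCHING ⇒ ONE-STEP FINITENESS OF THE MODEL.** `K = K̄`, `s` a `p`-fold state. If only finitely many pairs
`(j, b)` with `b_j = 0` are equimultiple points of the walk at `s` (`CentreBlowup.IsEquimultiplePoint p univ j b s`),
then the chosen blowing up of `𝔸⁵_K` at the origin carries only finitely many closed points of order `≥ p` of the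
transform of `(z^p + s.F)·𝒪` over the origin: by S3 (b) «POINTS» every such point is `chartImm_j (a, b)` with
`a = (−F′_j(b))^{1/p}` and `(j, b)` equimultiple. [cite: Hauser2010, §F (equiconstant points)]
[cite: BierstoneGrigorievMilmanWlodarczyk2011, §3.2 and Lemma 8.0.3 (2)] -/
theorem finite_closedOver_model_of_finite_pairs [IsAlgClosed K] [DecidableEq K] (s : State K)
    (hperm : (p : ℕ∞) ≤ CentreBlowup.ordAlong (Finset.univ : Finset (Fin 4)) s.F)
    (hfin : {jb : Fin 4 × (Fin 4 → K) | jb.2 jb.1 = 0 ∧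
      CentreBlowup.IsEquimultiplePoint p Finset.univ jb.1 jb.2 s}.Finite) :
    {w' : blowup (Scheme.IdealSheafData.vanishingIdeal (AffinePointBlowup.C₀ 4 K)) |
      IsClosed ({w'} : Set (blowup (Scheme.IdealSheafData.vanishingIdeal (AffinePointBlowup.C₀ 4 K)))) ∧
      blowup.π (Scheme.IdealSheafData.vanishingIdeal (AffinePointBlowup.C₀ 4 K)) w' = ξ 4 K ∧
      (p : ℕ∞) ≤ idealOrder ((⟨hypSheaf p s.F, [], p⟩ : MarkedIdeal (P 4 K)).transform
        (blowup.π (Scheme.IdealSheafData.vanishingIdeal (AffinePointBlowup.C₀ 4 K)))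
        (Scheme.IdealSheafData.vanishingIdeal (AffinePointBlowup.C₀ 4 K))).ideal w'}.Finite := by
  haveI : PerfectRing K p := PerfectRing.ofSurjective K p fun x => IsAlgClosed.exists_pow_nat_eq x hp.out.pos
  have hB := isBlowup_blowupπ_𝓘Λ_univ (K := K)
  -- the candidate points: `chartImm_j (a(b), b)` with `a(b)^p = -F′_j(b)`
  let pt : (Fin (4 + 1) → K) → P 4 K := fun v => ⟨MvPolynomial.vanishingIdeal K {v}, inferInstance⟩
  let root : Fin 4 × (Fin 4 → K) → K := fun jb =>
    (frobeniusEquiv K p).symm (-MvPolynomial.eval jb.2 (CentreBlowup.chartTransform p Finset.univ jb.1 s.F))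
  let f : Fin 4 × (Fin 4 → K) → blowup (Scheme.IdealSheafData.vanishingIdeal (AffinePointBlowup.C₀ 4 K)) :=
    fun jb => AffineCoordBlowup.chartImm hB (ChartDictionary.succ_mem_centreVars (Finset.mem_univ jb.1))
      (pt (Fin.cons (root jb) jb.2))
  refine (hfin.image f).subset fun w' hw' => ?_
  obtain ⟨hwc, hwξ, hord⟩ := hw'
  -- read the order in the coordinate-centre vocabulary and apply S3 (b) «POINTS»
  have hord' : (p : ℕ∞) ≤ idealOrder (controlledTransform
      (blowup.π (Scheme.IdealSheafData.vanishingIdeal (AffinePointBlowup.C₀ 4 K)))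
      (AffineCoordBlowup.𝓘Λ 4 K (insert 0 (Fin.succ '' ((Finset.univ : Finset (Fin 4)) : Set (Fin 4)))))
      (hypSheaf p s.F) p) w' := by
    rw [𝓘Λ_univ_eq_vanishingIdeal]
    exact hord
  obtain ⟨j, hj, x, a, b, hxw, hx, hab, heq⟩ :=
    (le_idealOrder_controlledTransform_iff_exists_chart s hperm hB hwc).mp hord'
  -- over the origin: `b_j = 0`
  have hbj : b j = 0 := by
    rw [← X_succ_mem_asIdeal_iff j a b hx, ← π_chartImm_mem_CΛ_iff hB hj x, hxw, hwξ, centreVars_univ,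
      AffineCoordBlowup.CΛ_univ]
    rfl
  -- `a` is THE `p`-th root
  have ha : root (j, b) = a := by
    apply (frobeniusEquiv K p).injective
    rw [RingEquiv.apply_symm_apply, frobeniusEquiv_def]
    exact (eq_neg_of_add_eq_zero_left hab).symm
  refine ⟨(j, b), ⟨hbj, heq⟩, ?_⟩
  have hxpt : pt (Fin.cons (root (j, b)) b) = x := by
    apply PrimeSpectrum.ext
    rw [ha, hx]
  change AffineCoordBlowup.chartImm hB (ChartDictionary.succ_mem_centreVars (Finset.mem_univ j))
    (pt (Fin.cons (root (j, b)) b)) = w'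
  rw [hxpt]
  exact hxw

/-- **Finitely many root parameters ⇒ finitely many closed order-`p` points of `(z^p + F)·𝒪` on `𝔸⁵_K`** (`K = K̄`):
every closed point of order `≥ p` is the rational point `((-F(b))^{1/p}, b)` for a `b` at which every non-constant
monomial of degree `< p` of `F(x + b)` vanishes. [cite: Hauser2010, §F (equiconstant points)] -/
theorem finite_closedPoints_of_finite_roots [IsAlgClosed K] (F : MvPolynomial (Fin 4) K)
    (hfin : {b : Fin 4 → K | ∀ d : Fin 4 →₀ ℕ, d ≠ 0 → d.degree < p →
      coeff d (PointBlowup.translate b F) = 0}.Finite) :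
    {x : P 4 K | IsClosed ({x} : Set (P 4 K)) ∧ (p : ℕ∞) ≤ idealOrder (hypSheaf p F) x}.Finite := by
  haveI : PerfectRing K p := PerfectRing.ofSurjective K p fun x => IsAlgClosed.exists_pow_nat_eq x hp.out.pos
  let pt : (Fin (4 + 1) → K) → P 4 K := fun v => ⟨MvPolynomial.vanishingIdeal K {v}, inferInstance⟩
  let g : (Fin 4 → K) → P 4 K := fun b => pt (Fin.cons ((frobeniusEquiv K p).symm (-MvPolynomial.eval b F)) b)
  refine (hfin.image g).subset fun x hx => ?_
  obtain ⟨hxc, hord⟩ := hx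
  obtain ⟨a, b, hxab⟩ := exists_eq_vanishingIdeal_cons_of_isClosed hxc
  have hord' := (natCast_le_idealOrder_hypSheaf_iff (p := p) F hxab p).mp hord
  rw [natCast_le_ordZero_translate_hyp_iff] at hord'
  obtain ⟨hab, H⟩ := hord'
  have ha : (frobeniusEquiv K p).symm (-MvPolynomial.eval b F) = a := by
    apply (frobeniusEquiv K p).injective
    rw [RingEquiv.apply_symm_apply, frobeniusEquiv_def]
    exact (eq_neg_of_add_eq_zero_left hab).symm
  refine ⟨b, H, ?_⟩
  apply PrimeSpectrum.ext
  change MvPolynomial.vanishingIdeal K {(Fin.cons ((frobeniusEquiv K p).symm (-MvPolynomial.eval b F)) b :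
    Fin (4 + 1) → K)} = x.asIdeal
  rw [ha, hxab]

/-- **TERMINATION ⇒ ORDER REDUCTION (MODE 0, isolated regime, hypotheses on the WALK ONLY).** `K = K̄` of
characteristic `p`, `F ≠ 0` clean. Suppose: (roots) only finitely many `b ∈ K⁴` make every non-constant monomial of
degree `< p` of `F(x + b)` vanish; and for every such `b`, with the re-centred root state
`s_b = (deletePthPowers p (F(x + b)), 0, ∅)`: (termination) the point-centre walk below `s_b` is well-founded (`Acc`),
and (finite branching) every state `s′` reachable from `s_b` by edges has only finitely many equimultiple pairs
`(j, b′)`, `b′_j = 0`. Then `(𝔸⁵_K, (z^p + F)·𝒪, [], p)` admits a marked resolution (BGMW Def. 3.1.3) — the conclusion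
of `PIDim4.OrderReduction p` for `F`. NOT `OrderReduction p` (finite branching = isolated order-`p` points at every
stage). [cite: BierstoneGrigorievMilmanWlodarczyk2011, Def. 3.1.3] [cite: Hauser2010, §§F–G]
[cite: Hironaka1964, Main Theorem I (the characteristic-zero statement whose analogue is asked)] -/
theorem exists_isMarkedResolution_of_walk [IsAlgClosed K] [DecidableEq K] (F : MvPolynomial (Fin 4) K) (hF : F ≠ 0)
    (hclean : Literature.Barriers.ResolutionOfSingularities.HauserPerlega.IsClean p F)
    (hroots : {b : Fin 4 → K | ∀ d : Fin 4 →₀ ℕ, d ≠ 0 → d.degree < p →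
      coeff d (PointBlowup.translate b F) = 0}.Finite)
    (hwalk : ∀ b : Fin 4 → K, (∀ d : Fin 4 →₀ ℕ, d ≠ 0 → d.degree < p → coeff d (PointBlowup.translate b F) = 0) →
      Acc (fun s' s : State K => Edge p Finset.univ s s')
          (⟨deletePthPowers p (PointBlowup.translate b F), 0, ∅⟩ : State K) ∧
        ∀ s' : State K, Relation.ReflTransGen (fun a c : State K => Edge p Finset.univ a c)
            (⟨deletePthPowers p (PointBlowup.translate b F), 0, ∅⟩ : State K) s' →
          {jb : Fin 4 × (Fin 4 → K) | jb.2 jb.1 = 0 ∧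
            CentreBlowup.IsEquimultiplePoint p Finset.univ jb.1 jb.2 s'}.Finite) :
    ∃ (X' : Scheme.{0}) (π : X' ⟶ P 4 K) (M' : MarkedIdeal X'),
      IsMarkedResolution (⟨hypSheaf p F, [], p⟩ : MarkedIdeal (P 4 K)) π M' := by
  refine exists_isMarkedResolution_of_forall_root F hF hclean (finite_closedPoints_of_finite_roots F hroots)
    fun a b _ H => ⟨(hwalk b H).1, fun s' hs' => ?_⟩
  exact finite_closedOver_model_of_finite_pairs s'
    (ordAlong_univ_of_reflTransGen_edge (ordAlong_univ_deletePthPowers_translate F b H) hs') ((hwalk b H).2 s' hs')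

omit hp [CharP K p] in
/-- **MODE-0 termination over `K` feeds the walk form.** If the MODE-0 step relation `Step0 p` of the target frame
(`p`-fold state + edge) admits no infinite chain over `K` (`WellFounded` of its flip), then the walk below every `p`-fold
state is well-founded in the sense used above (`Acc` of the flipped `Edge p univ`): edges out of `p`-fold states are
`Step0` steps and lead to `p`-fold states. [cite: Hauser2010, §F] -/
theorem acc_edge_of_wellFounded_step0 [DecidableEq K] (hwf : WellFounded (fun s' s : State K => Step0 p s s'))
    {s : State K} (hs : (p : ℕ∞) ≤ CentreBlowup.ordAlong (Finset.univ : Finset (Fin 4)) s.F) :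
    Acc (fun s' s : State K => Edge p Finset.univ s s') s := by
  have key : ∀ t : State K, Acc (fun s' s : State K => Step0 p s s') t →
      (p : ℕ∞) ≤ CentreBlowup.ordAlong (Finset.univ : Finset (Fin 4)) t.F →
      Acc (fun s' s : State K => Edge p Finset.univ s s') t := by
    intro t ht
    induction ht with
    | intro t _ ih =>
      intro hperm
      refine Acc.intro t fun t' hedge => ih t' ⟨hperm, hedge⟩ ?_
      obtain ⟨j, b, -, -, heq, -, hs'⟩ := hedge
      rw [hs']
      exact ordAlong_univ_step_of_isEquimultiplePoint j b t heq
  exact key s (hwf.apply s) hs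

/-- **TERMINATION OF MODE 0 ⇒ ORDER REDUCTION (isolated regime), in the target frame's vocabulary.** `K = K̄` of
characteristic `p`, `F ≠ 0` clean; the MODE-0 step relation `Step0 p` has no infinite chain over `K`; finitely many root
parameters; and every state reachable by edges from a re-centred root state is finitely branching. Then
`(𝔸⁵_K, (z^p + F)·𝒪, [], p)` admits a marked resolution. NOT `OrderReduction p`.
[cite: BierstoneGrigorievMilmanWlodarczyk2011, Def. 3.1.3] [cite: Hauser2010, §§F–G]
[cite: Hironaka1964, Main Theorem I (the characteristic-zero statement whose analogue is asked)] -/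
theorem exists_isMarkedResolution_of_wellFounded_step0 [IsAlgClosed K] [DecidableEq K] (F : MvPolynomial (Fin 4) K)
    (hF : F ≠ 0) (hclean : Literature.Barriers.ResolutionOfSingularities.HauserPerlega.IsClean p F)
    (hwf : WellFounded (fun s' s : State K => Step0 p s s'))
    (hroots : {b : Fin 4 → K | ∀ d : Fin 4 →₀ ℕ, d ≠ 0 → d.degree < p →
      coeff d (PointBlowup.translate b F) = 0}.Finite)
    (hbranch : ∀ b : Fin 4 → K, (∀ d : Fin 4 →₀ ℕ, d ≠ 0 → d.degree < p → coeff d (PointBlowup.translate b F) = 0) →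
      ∀ s' : State K, Relation.ReflTransGen (fun a c : State K => Edge p Finset.univ a c)
          (⟨deletePthPowers p (PointBlowup.translate b F), 0, ∅⟩ : State K) s' →
        {jb : Fin 4 × (Fin 4 → K) | jb.2 jb.1 = 0 ∧
          CentreBlowup.IsEquimultiplePoint p Finset.univ jb.1 jb.2 s'}.Finite) :
    ∃ (X' : Scheme.{0}) (π : X' ⟶ P 4 K) (M' : MarkedIdeal X'),
      IsMarkedResolution (⟨hypSheaf p F, [], p⟩ : MarkedIdeal (P 4 K)) π M' :=
  exists_isMarkedResolution_of_walk F hF hclean hroots fun b H =>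
    ⟨acc_edge_of_wellFounded_step0 hwf (ordAlong_univ_deletePthPowers_translate F b H), hbranch b H⟩

omit [CharP K p] in
/-- **ERRATUM — HONEST SCOPE OF THE COROLLARY ABOVE.** The `K`-global hypothesis
`WellFounded (fun s' s => Step0 p s s')` of `exists_isMarkedResolution_of_wellFounded_step0` is NEVER satisfied: MODE 0
has an infinite chain over EVERY field (the Whitney-umbrella cylinder `z^q + y·w^q`, tree `exists_infinite_step0_chain`,
cell rows C-001 / Z28). That corollary is therefore vacuously true and is NOT the S3 (c) headline; the headline is the
PER-ROOT form `exists_isMarkedResolution_of_walk` (termination required only below the root states of the given `F`).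
(K-remark of the Target owner typ-1 g2 and crit-3 g2's K-A3-12 rider, 2026-08-28.) [folklore] -/
theorem not_wellFounded_flip_step0 [DecidableEq K] : ¬ WellFounded (fun s' s : State K => Step0 p s s') := by
  intro hwf
  obtain ⟨c, hc⟩ := exists_infinite_step0_chain (q := p) hp.out.two_le K
  obtain ⟨m, hm, hmin⟩ := hwf.has_min (Set.range c) ⟨c 0, 0, rfl⟩
  obtain ⟨k, rfl⟩ := hm
  exact hmin (c (k + 1)) ⟨k + 1, rfl⟩ (hc k)

end Walk

end Equimultiple

end Summit.ResolutionOfSingularities.ResolutionOfSingularities.Theorems.PIDim4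

end
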